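import Summits.QuantumFields.YangMills.Theorems.BalabanUVNodesK0AxGaugeFlowRecDressed

/-!
# NODE O · K0ᴬ — PART B-2 of ★★★ №541 (R-a): THE THREE DISPLAYED ROWS OF THE LEG-DRESSED CHART `recordEmbJDressed F θ k K φ′` (DEF-1 ed.20) AT THE RECORD

LANDING NOTE (porter ▶ PTC-1 g4, 2026-08-31; AUTHORSHIP = ◇ lens-1 g10 «cauchy-analytic», HOME sketch `nodeO-cover/LENS-1g10-Rb-2-DressedRows.lean` sha16 3830d90ebad76472 · 144 l. · 6 thm · 0 def · 0 sorry):
landed VERBATIM (only this paragraph added) under the basename ◇ lens-1 proposed, on ★★★ director-ym №541 (R-a) ∕ №544 (c) («then PART B pieces») and ◆ CRIT-1 g36's cut of PART B: PASS ×3 — GO to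
land in order B-1 → B-2 → B-3, basenames as proposed; standing (Q-ord) check PASS; J5′ census 0 HIT; J1′ junk canaries excluded; axioms standard on ◆'s own runs (nodeO STATUS
2026-08-31T09:48:32Z);
helper `--supports stmt-QuantumFields-27238 --as helper` (NO `--workitem`).  PART B-2 of three (imports B-1 ✓`…K0AxGaugeFlowRecDressed`; consumed by B-3 `…K0AxJoinTDressed`); DEF-1
ed.20∕ed.21∕Lemmas15 letters consumed BY NAME, no twin.  HONEST (porter): calculus ∕ bookkeeping ∕ CONDITIONAL assembly over DISPLAYED rows
(D1 = ⟨27930⟩'s ⁸ consequent, `DressLink` ⟸ (C-orb) `RootedResponseOrbitAt` mod P0, HypAn, (Tok-cmpU-cap) — all OPEN, asserted nowhere); [E] inhabited unconditionally NOWHERE; nothing of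
Bałaban asserted, ported, discharged or refuted; K0ᴬ stmt-QuantumFields-27238 OPEN — NOTHING of it proved; NODE O 0∕1; COUNT 8∕28 · K 1∕4 UNMOVED; finite 𝕋⁴ at fixed ε — NOT continuum ∕ OS ∕ Clay;
the Yang–Mills mass gap is NOT proved by any of this.

◇ `ymgap-nodeO-lens-1` g10 (planner; typed for the porter ▶ PTC-1 g4; proposed target `Summits/QuantumFields/YangMills/Theorems/BalabanUVNodesK0RecordFormatNamesDressedRows.lean`,
imports PART B-1 `…K0AxGaugeFlowRecDressed` (which imports ✓`…K0RecordFormatNamesLemmas15`); `--supports stmt-QuantumFields-27238 --as helper`).  Items: K0ᴬ 27238 OPEN; K0⁷ 20541 OPEN.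

BY NAME at `lamOf := recordDressPot F θ k K φ′` (ℝ-linear — (B1) a CLM; `recordDressPot φ′ (δ_l ⊗ bV a) = φ′ l a`) and `ι := recordEmbJ F θ k K`:
 (ra-3) `ContDiffAt ℝ n (recordEmbJDressed … φ′) 0` ⟸ HypAn `ContDiffAt ℝ n (recordEmbJ …) 0` + `recordEmbJ … 0 = 0`; ★★ the LINEARISATION
        `fderiv ℝ (recordEmbJDressed … φ′) 0 (δ_l ⊗ bV a) = recordGkJ a l + recordGradLeg (φ′ l a)` (rooted two-block response PLUS the gradient leg), hence under the DISPLAYED receipt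
        `DressLink F θ k K φ′` (DEF-1) the LINK ROW `recordGkLocWξ … univ a l = fderiv ℝ (recordEmbJDressed … φ′) 0 (δ_l ⊗ bV a)` of ★★★`K0AxJoinT.twoVolExp_LocUniv_of_cmp`;
 (ra-1) ★★ the SWAP ROW `χ_X(recordEmbJDressed φ′ B) = (χ_X(recordEmbJ B))^{g_B}` near `B = 0`, `g_B := expGauge (recordDressPot φ′ B) 1` ⟸ `ContinuousAt (recordEmbJ …) 0` + `recordEmbJ … 0 = 0`;
 value row = ✓`recordEmbJDressed_zero ∕ _thetaFill` (DEF-1's Lemmas15, BY NAME — not restated).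
RIDER (r1): `φ′` is a PARAMETER; (r2): no identity between the rooted tables `recordGkL ∕ recordHr ∕ recordD` and `recordGkLocWξ univ` is displayed or used (J5′-exempt).
HONEST: `DressLink` and HypAn stay DISPLAYED (suppliers (C-orb) `RootedResponseOrbitAt` mod P0 and [14]∕[15] analyticity — OPEN content, asserted nowhere); [E] inhabited
unconditionally NOWHERE; nothing of Bałaban asserted, ported or discharged; K0ᴬ 27238 ∕ K0⁷ 20541 OPEN; NODE O 0∕1; COUNT 8∕28 · K 1∕4 UNMOVED; finite `𝕋⁴_{L^K}` at fixed ε — NOT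
continuum ∕ OS ∕ Clay; **the Yang–Mills mass gap is NOT proved.**  No `instance ∕ notation ∕ allowUnsafeReducibility`; 0 sorry; standard axioms.
-/

noncomputable section

open scoped BigOperators Matrix.Norms.L2Operator Topology
open Set Filter Metric

/-! ## §B  BY NAME at the record: `lamOf := recordDressPot F θ k K φ′`, `ι := recordEmbJ F θ k K` -/

namespace Summit.QuantumFields.YangMills.Theorems.K0RecordFormatNames

open Literature.MathematicalPhysics.QuantumFieldTheory.Balaban1983to89
open Literature.MathematicalPhysics.QuantumFieldTheory.Balaban1983to89.Node00
open Literature.MathematicalPhysics.QuantumFieldTheory.Balaban1983to89.T4Continuum (T4Family)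
open Summit.QuantumFields.YangMills.Theorems.K0AxGaugeFlowRec

variable (F : T4Family)

section Theta

variable (θ : Stage13Params F 2)

/-- (B1) The dressing potential `recordDressPot F θ k K φ′ B` is a continuous ℝ-linear function of the basis field `B`. [cite: Balaban1987RG1, (1.10) p.262 (bookkeeping)] -/
theorem exists_recordDressPotCLM (k K : ℕ) (φ' : RespLabel F k K → θ.ιβ → Site (F.P K) 0 → Fin 3 → ℂ) :
    letI := θ.instVβ₁; letI := θ.instVβ₂
    ∃ Lp : (Fin (F.P K).d → Site (F.P K) (k + 1) → θ.Vβ) →L[ℝ] (Site (F.P K) 0 → Fin 3 → ℂ), ∀ B, Lp B = recordDressPot F θ k K φ' B := by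
  letI := θ.instVβ₁; letI := θ.instVβ₂; letI := θ.instιβ
  haveI : FiniteDimensional ℝ θ.Vβ := Module.Finite.of_basis θ.bV
  refine ⟨LinearMap.toContinuousLinearMap
    { toFun := fun B => recordDressPot F θ k K φ' B
      map_add' := fun B B' => ?_
      map_smul' := fun t B => ?_ }, fun _ => rfl⟩
  · funext x c
    simp only [recordDressPot, Pi.add_apply, map_add, Finsupp.coe_add, Complex.ofReal_add, add_mul, Finset.sum_add_distrib]
  · funext x c
    simp only [recordDressPot, Pi.smul_apply, map_smul, Finsupp.coe_smul, smul_eq_mul, Complex.ofReal_mul, mul_assoc, RingHom.id_apply,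
      Complex.real_smul, Finset.mul_sum]

/-- (B1) On the basis field `δ_l ⊗ bV a` the dressing potential is the table entry `φ′ l a`. [cite: Balaban1987RG1, (1.10) p.262 (bookkeeping)] -/
theorem recordDressPot_single (k K : ℕ) (φ' : RespLabel F k K → θ.ιβ → Site (F.P K) 0 → Fin 3 → ℂ) (a : θ.ιβ) (l : RespLabel F k K) :
    letI := θ.instVβ₁; letI := θ.instVβ₂; letI := θ.instιβ
    recordDressPot F θ k K φ' (Pi.single l.1 (Pi.single l.2 (θ.bV a))) = φ' l a := by
  letI := θ.instVβ₁; letI := θ.instVβ₂; letI := θ.instιβ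
  classical
  funext x c
  simp only [recordDressPot]
  have hoff : ∀ l' : RespLabel F k K, l' ≠ l → ∀ a' : θ.ιβ,
      ((θ.bV.repr ((Pi.single l.1 (Pi.single l.2 (θ.bV a)) : Fin (F.P K).d → Site (F.P K) (k + 1) → θ.Vβ) l'.1 l'.2) a' : ℝ) : ℂ) * φ' l' a' x c = 0 := by
    intro l' hl' a'
    have hz : (Pi.single l.1 (Pi.single l.2 (θ.bV a)) : Fin (F.P K).d → Site (F.P K) (k + 1) → θ.Vβ) l'.1 l'.2 = 0 := by
      by_cases h1 : l'.1 = l.1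
      · have h2 : l'.2 ≠ l.2 := fun h2 => hl' (Prod.ext h1 h2)
        rw [h1, Pi.single_eq_same, Pi.single_eq_of_ne h2]
      · rw [Pi.single_eq_of_ne h1, Pi.zero_apply]
    rw [hz, map_zero, Finsupp.zero_apply, Complex.ofReal_zero, zero_mul]
  rw [Finset.sum_eq_single l (fun l' _ hl' => Finset.sum_eq_zero fun a' _ => hoff l' hl' a') (fun h => absurd (Finset.mem_univ l) h),
    Pi.single_eq_same, Pi.single_eq_same, Module.Basis.repr_self,
    Finset.sum_eq_single a (fun a' _ ha' => by rw [Finsupp.single_apply, if_neg (fun h => ha' h.symm), Complex.ofReal_zero, zero_mul])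
      (fun h => absurd (Finset.mem_univ a) h),
    Finsupp.single_apply, if_pos rfl, Complex.ofReal_one, one_mul]

/-- (ra-3) ★ **SMOOTHNESS OF THE LEG-DRESSED CHART** from the undressed chart's (HypAn): `ContDiffAt ℝ n (recordEmbJ …) 0 ∧ recordEmbJ … 0 = 0 ⟹ ContDiffAt ℝ n (recordEmbJDressed … φ′) 0`.
HONEST: HypAn is DISPLAYED ([14] (1.1)–(1.6), [15] (8)–(10) — OPEN content). [cite: Balaban1987RG1, (4.8) p.283, (1.10) p.262; Balaban1985Variational, (8)–(10) p.22] -/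
theorem contDiffAt_recordEmbJDressed (k K : ℕ) (φ' : RespLabel F k K → θ.ιβ → Site (F.P K) 0 → Fin 3 → ℂ) {n : WithTop ℕ∞} :
    letI := θ.instVβ₁; letI := θ.instVβ₂
    ContDiffAt ℝ n (recordEmbJ F θ k K) 0 → recordEmbJ F θ k K 0 = 0 → ContDiffAt ℝ n (recordEmbJDressed F θ k K φ') 0 := by
  letI := θ.instVβ₁; letI := θ.instVβ₂
  intro hι h0
  obtain ⟨Lp, hLp⟩ := exists_recordDressPotCLM F θ k K φ'
  have hfun : recordEmbJDressed F θ k K φ' = fun B => gaugeFlowMap F K (expGauge F K (Lp B) 1) (recordEmbJ F θ k K B) := by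
    funext B; rw [recordEmbJDressed_eq, hLp]
  rw [hfun]
  exact contDiffAt_dressed F K Lp hι h0

/-- (ra-3) ★★ **LINEARISATION OF THE LEG-DRESSED CHART**: `∂_B|₀ recordEmbJDressed φ′ (δ_l ⊗ bV a) = recordGkJ a l + recordGradLeg (φ′ l a)` — the rooted two-block response
PLUS the gradient leg of the potential `φ′ l a`. [cite: Balaban1987RG1, (4.8) p.283, (4.15) p.284, (4.35) p.290, (1.10) p.262] -/
theorem fderiv_recordEmbJDressed_single (k K : ℕ) (φ' : RespLabel F k K → θ.ιβ → Site (F.P K) 0 → Fin 3 → ℂ) (a : θ.ιβ) (l : RespLabel F k K) :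
    letI := θ.instVβ₁; letI := θ.instVβ₂; letI := θ.instιβ
    DifferentiableAt ℝ (recordEmbJ F θ k K) 0 → recordEmbJ F θ k K 0 = 0 →
      fderiv ℝ (recordEmbJDressed F θ k K φ') 0 (Pi.single l.1 (Pi.single l.2 (θ.bV a))) = fun i => recordGkJ F θ k K a l i + recordGradLeg F K (φ' l a) i := by
  letI := θ.instVβ₁; letI := θ.instVβ₂; letI := θ.instιβ
  intro hι h0
  obtain ⟨Lp, hLp⟩ := exists_recordDressPotCLM F θ k K φ'
  have hfun : recordEmbJDressed F θ k K φ' = fun B => gaugeFlowMap F K (expGauge F K (Lp B) 1) (recordEmbJ F θ k K B) := by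
    funext B; rw [recordEmbJDressed_eq, hLp]
  rw [hfun, fderiv_dressed_apply F K Lp hι h0, hLp, recordDressPot_single]
  funext i
  rw [Pi.add_apply, add_comm]
  rfl

/-- (ra-3) ★★ **THE LINK ROW UNDER `DressLink`**: given the DISPLAYED receipt `DressLink F θ k K φ′` (DEF-1: `recordGkJ + recordGradLeg (φ′ l a) = recordGkLocWξ univ`), the
leg-dressed chart's linearisation IS the transverse LocUniv table — the link row of ★★★`K0AxJoinT.twoVolExp_LocUniv_of_cmp` at `ιC := recordEmbJDressed … φ′`.
HONEST: `DressLink` is asserted for nothing (supplier (C-orb) `RootedResponseOrbitAt` mod P0, OPEN). [cite: Balaban1987RG1, (4.35)–(4.37) pp.290–291, (4.8) p.283, (4.15) p.284] -/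
theorem recordGkLocWξ_univ_eq_fderiv_recordEmbJDressed (k K : ℕ) (φ' : RespLabel F k K → θ.ιβ → Site (F.P K) 0 → Fin 3 → ℂ)
    (hDL : DressLink F θ k K φ') (a : θ.ιβ) (l : RespLabel F k K) :
    letI := θ.instVβ₁; letI := θ.instVβ₂; letI := θ.instιβ
    DifferentiableAt ℝ (recordEmbJ F θ k K) 0 → recordEmbJ F θ k K 0 = 0 →
      recordGkLocWξ F θ k K Finset.univ a l = fun i => fderiv ℝ (recordEmbJDressed F θ k K φ') 0 (Pi.single l.1 (Pi.single l.2 (θ.bV a))) i := by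
  letI := θ.instVβ₁; letI := θ.instVβ₂; letI := θ.instιβ
  intro hι h0
  rw [fderiv_recordEmbJDressed_single F θ k K φ' a l hι h0]
  funext i
  exact (hDL a l i).symm

/-- (ra-1) ★★ **THE SWAP ROW OF THE LEG-DRESSED CHART AT THE RECORD**: near `B = 0`, `χ_X(recordEmbJDressed φ′ B) = (χ_X(recordEmbJ B))^{g_B}` on `recordCoords X` with
`g_B := expGauge (recordDressPot φ′ B) 1 ∈ recordGaugeGrp` — the swap row of ★★★`K0AxJoinT.twoVolExp_LocUniv_of_cmp` at `ιC := recordEmbJDressed … φ′`, from continuity of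
`recordEmbJ` at `0` and `recordEmbJ 0 = 0`. [cite: Balaban1987RG1, (4.8) p.283, (1.7) p.261, (1.10) p.262] -/
theorem eventually_recordChartJ_recordEmbJDressed (Mc k K : ℕ) (φ' : RespLabel F k K → θ.ιβ → Site (F.P K) 0 → Fin 3 → ℂ) :
    letI := θ.instVβ₁; letI := θ.instVβ₂
    ContinuousAt (recordEmbJ F θ k K) 0 → recordEmbJ F θ k K 0 = 0 →
      ∀ᶠ B in 𝓝 (0 : Fin (F.P K).d → Site (F.P K) (k + 1) → θ.Vβ), ∀ X : (recordDomSys F Mc k K).Dom, ∃ g : recordGaugeGrp F K,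
        ∀ i ∈ recordCoords F Mc k K X,
          recordChartJ F Mc k K X (recordEmbJDressed F θ k K φ' B) i = recordAct F K g (recordChartJ F Mc k K X (recordEmbJ F θ k K B)) i := by
  letI := θ.instVβ₁; letI := θ.instVβ₂
  intro hι h0
  obtain ⟨Lp, hLp⟩ := exists_recordDressPotCLM F θ k K φ'
  have hfun : recordEmbJDressed F θ k K φ' = fun B => gaugeFlowMap F K (expGauge F K (Lp B) 1) (recordEmbJ F θ k K B) := by
    funext B; rw [recordEmbJDressed_eq, hLp]
  rw [hfun]
  exact eventually_recordChartJ_dressed F Mc k K Lp hι h0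

end Theta

end Summit.QuantumFields.YangMills.Theorems.K0RecordFormatNames

end
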